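import Summits.Ventures.PercRepro.C041TriDomAbsorb
import Summits.Ventures.PercRepro.C041TriDomExcessA
import Summits.Ventures.PercRepro.C041RelaxedD1
import Summits.Ventures.PercRepro.C041RelaxedD2

/-!
# ROW C-041 — (P)-DOMINATION: THE DIAMONDS AS ABSORBERS OF THE APART EXCESS — (P) and the ZONE O-CUBE at cone inputs
beyond triangle domination (p6, gen 40; P6-TWOEXIT-LEAN.md §52 ADDENDUM 2)

For (P) at cone inputs (`K4v`, a convex cone) the dictionary of maps known to preserve it is larger than the dictionary
of cone maps: besides the triangle at its four transforms and the manifest maps, THEOREM (RELAXED K₄ − uu′) and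
THEOREM (RELAXED K₄ − au) of gen 38 (`K4v_thetaD1_of_inCone`, `K4v_thetaD2_of_inCone`) give the two diamonds, and
in the 14-atom normal form each diamond carries TWO units of apart excess (`thetaD1_eq_excess`, `thetaD2_eq_excess`:
`Θ_{D1} = θ_△ + Q′ + 3 ℓψ(w) w′ + 3 w ℓψ(w′) + 2 ℓψ(w) ℓψ(w′) + 2 w w′`, `Θ_{D2} = θ_△ + Q′ + 3 ℓψ(w w′) + 3 ℓψ(w) w′
+ 2 ℓψ(ℓψ(w) w′) + 2 w w′`).  THEOREM ((P)-ABSORBERS) (`blockMap_ex2_eq_absorbP`): with `c, c₁, c₂, c₃, d` cone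
absorptions and `f₁` / `f₂` diamond absorptions covered by the type counts (fourteen count equations),
`Θ = (the cone absorbers) + f₁ • Θ_{D1} + f₂ • Θ_{D2} + e″ • Q′ + (manifest)`; with `e″ = 0`: (P) and the ZONE O-CUBE
at the host with ANY two cone zones (`K4v_blockMap_ex2_of_absorbP`, `zoneOCube_blockMap_ex2_of_absorbP`) — a theorem
for every host whose counts allow it, in particular (own census, lean-drafts/p6/g40/pdom.py) for 66 of the 246
six-vertex two-exit cores that are NOT triangle-dominated (e.g. the core with edges 01 02 03 04 05 13 14 15 25 34:
`Θ = 16 Θ_{D1} + 160 w ℓψ(w′) + 192 w w′`), where (P) at cone inputs was open.  (Adding the seventeen Rel-adequate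
five-vertex cores of gen 38 as absorbers reaches 116 / 246; the six five-vertex cores c5_10, 11, 13, 23, 24, 27 are
absorbed by nothing in the record.)
-/

namespace PercRepro

namespace ZoneZ

namespace MultiExit

open ZoneData Pendant Finset TwoExit TreeClosure RelaxedTriangle

variable {V₁ E₁ U₁ U₂ : Type} (Z₁ : ZoneData V₁ E₁ U₁ U₂) (u u' a₁ : V₁) [Fintype E₁] [DecidableEq E₁]

/-- **THEOREM ((P)-ABSORBERS)**: the cone absorbers, `f₁` diamonds `K₄ − uu′` and `f₂` diamonds `K₄ − au`, `e″` bare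
apart excesses and manifest maps. -/
theorem blockMap_ex2_eq_absorbP (c c₁ c₂ c₃ d f₁ f₂ s₀ s₁ s₂ s₃ s₄ s₅ s₆ s₇ s₈ s₉ s₁₀ s₁₁ s₁₂ E : ℕ)
    (h0 : tcount Z₁ u u' a₁ (false, true, false, true, false, true) =
      c + c₁ + c₂ + 2 * c₃ + d + 2 * f₁ + 2 * f₂ + E + tcount Z₁ u u' a₁ (false, true, true, false, false, false)
        + tcount Z₁ u u' a₁ (false, false, false, true, true, false)
        + tcount Z₁ u u' a₁ (false, true, false, false, true, false))
    (h1 : tcount Z₁ u u' a₁ (false, true, false, true, true, true) = c + f₁ + 4 * f₂ + s₁)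
    (h2 : tcount Z₁ u u' a₁ (false, true, true, false, false, false) = c₁ + c₂ + 2 * c₃ + 2 * f₁ + s₂)
    (h3 : tcount Z₁ u u' a₁ (false, false, false, true, true, false) = c₂ + 2 * f₂ + s₃)
    (h4 : tcount Z₁ u u' a₁ (false, true, false, false, true, false) = c₁ + s₄)
    (h5 : tcount Z₁ u u' a₁ (true, false, true, true, true, false) = c + c₂ + 4 * f₁ + 4 * f₂ + s₅)
    (h6 : tcount Z₁ u u' a₁ (true, true, true, false, true, false) = c + c₁ + 4 * f₁ + f₂ + s₆)
    (hX : tcount Z₁ u u' a₁ (true, true, true, true, true, true) = 2 * f₁ + 2 * f₂ + s₀)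
    (h7 : tcount Z₁ u u' a₁ (false, false, false, true, false, false) = c₂ + 4 * c₃ + d + s₇)
    (h8 : tcount Z₁ u u' a₁ (false, true, false, false, false, false) = c₁ + 4 * c₃ + d + s₈)
    (h9 : tcount Z₁ u u' a₁ (false, false, true, true, false, false) = 2 * c₂ + s₉)
    (h10 : tcount Z₁ u u' a₁ (true, true, false, false, false, false) = 2 * c₁ + s₁₀)
    (h11 : tcount Z₁ u u' a₁ (false, false, false, false, true, true)
      + tcount Z₁ u u' a₁ (false, false, false, false, true, false) = c₃ + d + s₁₁)
    (h12 : tcount Z₁ u u' a₁ (false, false, false, false, true, false)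
      + tcount Z₁ u u' a₁ (false, false, false, false, false, false) = 3 * c₃ + d + s₁₂) (w w' : Vec6) :
    blockMap Z₁ (ex2 u u') a₁ (fun b => if b then w' else w) =
      (c : ℝ) • thetaTri w w' + (c₁ : ℝ) • thetaTri w (ellv w') + (c₂ : ℝ) • thetaTri (ellv w) w'
        + (c₃ : ℝ) • thetaTri (ellv w) (ellv w') + (d : ℝ) • ellv (ellv w * ellv w')
        + (f₁ : ℝ) • thetaD1 w w' + (f₂ : ℝ) • thetaD2 w w'
        + (E : ℝ) • apartExcess w w'
        + (s₁ : ℝ) • ellv (w * w') + (s₂ : ℝ) • (ellv w * ellv w') + (s₃ : ℝ) • ellv (ellv w * w')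
        + (s₄ : ℝ) • ellv (w * ellv w') + (s₅ : ℝ) • (ellv w * w') + (s₆ : ℝ) • (w * ellv w')
        + (s₀ : ℝ) • (w * w')
        + (s₇ : ℝ) • (nAdm w • ellv w') + (s₈ : ℝ) • (nAdm w' • ellv w) + (s₉ : ℝ) • (nAdm w • w')
        + (s₁₀ : ℝ) • (nAdm w' • w) + (s₁₁ : ℝ) • (nAdm (w * w') • (1 : Vec6))
        + (s₁₂ : ℝ) • ((nAdm w * nAdm w') • (1 : Vec6)) := by
  have hN := blockMap_ex2_eq_normal Z₁ u u' a₁ w w'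
  rw [excess, h0, h2, h3, h4] at hN
  have h11' : (tcount Z₁ u u' a₁ (false, false, false, false, true, true) : ℝ)
      + tcount Z₁ u u' a₁ (false, false, false, false, true, false) = ((c₃ + d + s₁₁ : ℕ) : ℝ) := by
    rw [← Nat.cast_add, h11]
  have h12' : (tcount Z₁ u u' a₁ (false, false, false, false, true, false) : ℝ)
      + tcount Z₁ u u' a₁ (false, false, false, false, false, false) = ((3 * c₃ + d + s₁₂ : ℕ) : ℝ) := by
    rw [← Nat.cast_add, h12]
  rw [hN, h1, h5, h6, hX, h7, h8, h9, h10, h11', h12', thetaD1_eq_excess, thetaD2_eq_excess, thetaTri_eq_apartExcess,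
    thetaTri_w_ellv, thetaTri_ellv_w, thetaTri_ellv_ellv, ellv_ellv_mul_ellv]
  push_cast
  ext i
  simp only [Pi.add_apply, Pi.smul_apply, smul_eq_mul]
  ring

/-- **(P) AT A HOST WHOSE EXCESS IS ABSORBED BY TRIANGLES, STAR TREES AND DIAMONDS, WITH TWO CONE ZONES.** -/
theorem K4v_blockMap_ex2_of_absorbP (c c₁ c₂ c₃ d f₁ f₂ s₀ s₁ s₂ s₃ s₄ s₅ s₆ s₇ s₈ s₉ s₁₀ s₁₁ s₁₂ : ℕ)
    (h0 : tcount Z₁ u u' a₁ (false, true, false, true, false, true) =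
      c + c₁ + c₂ + 2 * c₃ + d + 2 * f₁ + 2 * f₂ + 0 + tcount Z₁ u u' a₁ (false, true, true, false, false, false)
        + tcount Z₁ u u' a₁ (false, false, false, true, true, false)
        + tcount Z₁ u u' a₁ (false, true, false, false, true, false))
    (h1 : tcount Z₁ u u' a₁ (false, true, false, true, true, true) = c + f₁ + 4 * f₂ + s₁)
    (h2 : tcount Z₁ u u' a₁ (false, true, true, false, false, false) = c₁ + c₂ + 2 * c₃ + 2 * f₁ + s₂)
    (h3 : tcount Z₁ u u' a₁ (false, false, false, true, true, false) = c₂ + 2 * f₂ + s₃)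
    (h4 : tcount Z₁ u u' a₁ (false, true, false, false, true, false) = c₁ + s₄)
    (h5 : tcount Z₁ u u' a₁ (true, false, true, true, true, false) = c + c₂ + 4 * f₁ + 4 * f₂ + s₅)
    (h6 : tcount Z₁ u u' a₁ (true, true, true, false, true, false) = c + c₁ + 4 * f₁ + f₂ + s₆)
    (hX : tcount Z₁ u u' a₁ (true, true, true, true, true, true) = 2 * f₁ + 2 * f₂ + s₀)
    (h7 : tcount Z₁ u u' a₁ (false, false, false, true, false, false) = c₂ + 4 * c₃ + d + s₇)
    (h8 : tcount Z₁ u u' a₁ (false, true, false, false, false, false) = c₁ + 4 * c₃ + d + s₈)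
    (h9 : tcount Z₁ u u' a₁ (false, false, true, true, false, false) = 2 * c₂ + s₉)
    (h10 : tcount Z₁ u u' a₁ (true, true, false, false, false, false) = 2 * c₁ + s₁₀)
    (h11 : tcount Z₁ u u' a₁ (false, false, false, false, true, true)
      + tcount Z₁ u u' a₁ (false, false, false, false, true, false) = c₃ + d + s₁₁)
    (h12 : tcount Z₁ u u' a₁ (false, false, false, false, true, false)
      + tcount Z₁ u u' a₁ (false, false, false, false, false, false) = 3 * c₃ + d + s₁₂)
    {w w' : Vec6} (hw : InCone w) (hw' : InCone w') :
    K4v (blockMap Z₁ (ex2 u u') a₁ (fun b => if b then w' else w)) := by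
  rw [blockMap_ex2_eq_absorbP Z₁ u u' a₁ c c₁ c₂ c₃ d f₁ f₂ s₀ s₁ s₂ s₃ s₄ s₅ s₆ s₇ s₈ s₉ s₁₀ s₁₁ s₁₂ 0 h0 h1 h2 h3 h4 h5 h6 hX h7 h8 h9 h10 h11 h12]
  obtain ⟨m1, m2, m3, m4, m5, m6, m7, m8, m9, m10, m11, m12, m13⟩ := InCone_manifest hw hw'
  have hl := inCone_ellv hw
  have hl' := inCone_ellv hw'
  have hK1 : K4v (thetaD1 w w') := RelaxedCores.K4v_thetaD1_of_inCone hw hw'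
  have hK2 : K4v (thetaD2 w w') := RelaxedCores.K4v_thetaD2_of_inCone hw hw'
  generalize thetaD1 w w' = X1 at hK1 ⊢
  generalize thetaD2 w w' = X2 at hK2 ⊢
  simp only [Nat.cast_zero, zero_smul, add_zero]
  repeat' apply K4v_add
  all_goals refine K4v_smul ?_ (by positivity)
  all_goals first
    | exact hK1
    | exact hK2
    | exact K4v_thetaTri_of_InCone hw hw'
    | exact K4v_thetaTri_of_InCone hw hl'
    | exact K4v_thetaTri_of_InCone hl hw'
    | exact K4v_thetaTri_of_InCone hl hl'
    | exact K4v_of_InCone (inCone_ellv (hl.mul hl'))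
    | exact K4v_of_InCone m1
    | exact K4v_of_InCone m2
    | exact K4v_of_InCone m3
    | exact K4v_of_InCone m4
    | exact K4v_of_InCone m5
    | exact K4v_of_InCone m6
    | exact K4v_of_InCone m7
    | exact K4v_of_InCone m8
    | exact K4v_of_InCone m9
    | exact K4v_of_InCone m10
    | exact K4v_of_InCone m11
    | exact K4v_of_InCone m12
    | exact K4v_of_InCone m13

/-- The ZONE O-CUBE at a host whose excess is absorbed by triangles, star trees and diamonds, with two cone zones:
`2F ≤ T₁ + T₂ + 2I`. -/
theorem zoneOCube_blockMap_ex2_of_absorbP (c c₁ c₂ c₃ d f₁ f₂ s₀ s₁ s₂ s₃ s₄ s₅ s₆ s₇ s₈ s₉ s₁₀ s₁₁ s₁₂ : ℕ)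
    (h0 : tcount Z₁ u u' a₁ (false, true, false, true, false, true) =
      c + c₁ + c₂ + 2 * c₃ + d + 2 * f₁ + 2 * f₂ + 0 + tcount Z₁ u u' a₁ (false, true, true, false, false, false)
        + tcount Z₁ u u' a₁ (false, false, false, true, true, false)
        + tcount Z₁ u u' a₁ (false, true, false, false, true, false))
    (h1 : tcount Z₁ u u' a₁ (false, true, false, true, true, true) = c + f₁ + 4 * f₂ + s₁)
    (h2 : tcount Z₁ u u' a₁ (false, true, true, false, false, false) = c₁ + c₂ + 2 * c₃ + 2 * f₁ + s₂)
    (h3 : tcount Z₁ u u' a₁ (false, false, false, true, true, false) = c₂ + 2 * f₂ + s₃)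
    (h4 : tcount Z₁ u u' a₁ (false, true, false, false, true, false) = c₁ + s₄)
    (h5 : tcount Z₁ u u' a₁ (true, false, true, true, true, false) = c + c₂ + 4 * f₁ + 4 * f₂ + s₅)
    (h6 : tcount Z₁ u u' a₁ (true, true, true, false, true, false) = c + c₁ + 4 * f₁ + f₂ + s₆)
    (hX : tcount Z₁ u u' a₁ (true, true, true, true, true, true) = 2 * f₁ + 2 * f₂ + s₀)
    (h7 : tcount Z₁ u u' a₁ (false, false, false, true, false, false) = c₂ + 4 * c₃ + d + s₇)
    (h8 : tcount Z₁ u u' a₁ (false, true, false, false, false, false) = c₁ + 4 * c₃ + d + s₈)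
    (h9 : tcount Z₁ u u' a₁ (false, false, true, true, false, false) = 2 * c₂ + s₉)
    (h10 : tcount Z₁ u u' a₁ (true, true, false, false, false, false) = 2 * c₁ + s₁₀)
    (h11 : tcount Z₁ u u' a₁ (false, false, false, false, true, true)
      + tcount Z₁ u u' a₁ (false, false, false, false, true, false) = c₃ + d + s₁₁)
    (h12 : tcount Z₁ u u' a₁ (false, false, false, false, true, false)
      + tcount Z₁ u u' a₁ (false, false, false, false, false, false) = 3 * c₃ + d + s₁₂)
    {w w' : Vec6} (hw : InCone w) (hw' : InCone w') :
    0 ≤ (blockMap Z₁ (ex2 u u') a₁ (fun b => if b then w' else w) 1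
          - blockMap Z₁ (ex2 u u') a₁ (fun b => if b then w' else w) 0)
        + (blockMap Z₁ (ex2 u u') a₁ (fun b => if b then w' else w) 2
          - blockMap Z₁ (ex2 u u') a₁ (fun b => if b then w' else w) 0)
        + 2 * (blockMap Z₁ (ex2 u u') a₁ (fun b => if b then w' else w) 4
          + blockMap Z₁ (ex2 u u') a₁ (fun b => if b then w' else w) 5
          - blockMap Z₁ (ex2 u u') a₁ (fun b => if b then w' else w) 3)
        - 2 * blockMap Z₁ (ex2 u u') a₁ (fun b => if b then w' else w) 0 :=
  zoneOCube_nonneg_of_K4 (K4v_blockMap_ex2_of_absorbP Z₁ u u' a₁ c c₁ c₂ c₃ d f₁ f₂ s₀ s₁ s₂ s₃ s₄ s₅ s₆ s₇ s₈ s₉ s₁₀ s₁₁ s₁₂ h0 h1 h2 h3 h4 h5 h6 hX h7 h8 h9 h10 h11 h12 hw hw')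

end MultiExit

end ZoneZ

end PercRepro
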